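import Literature.Algebra.Homology.OrderedCechMap
import HarnessLib

/-!
# Short exact sequences of ordered Čech complexes: hypotheses on non-empty index sets only

`Literature/Algebra/Homology/OrderedCechMap` proves (`OrderedCech.shortExact_familySC`) that a
sequence of families `E s → F s → G s` of submodules which is short exact for EVERY finite index set
`s` gives a short exact sequence of ordered Čech complexes `0 → Č(E) → Č(F) → Č(G) → 0`. The Čech
complexes only involve the simplices, i.e. the NON-EMPTY `s` (`OrderedCech.Simplex`), so the
hypotheses are only needed for non-empty `s`; this file records that sharper form
(`OrderedCech.shortExact_familySC_of_nonempty`), which is the one available when `G ∅` is a module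
of global sections onto which nothing algebraic surjects (e.g. `Γ(Z, 𝒪_Z(E))` for a line bundle on a
projective scheme, compared with the degree-zero part of a graded module).

Fully proved bookkeeping; no named facts.

## References

* U. Görtz, T. Wedhorn, *Algebraic Geometry II* (2023), Def. 21.68 (p. 260). [GortzWedhorn2023]
* The Stacks Project, Tag 01EV. [StacksProject]
-/

noncomputable section

universe u v

open CategoryTheory Finset

namespace Literature.Algebra.Homology

namespace OrderedCech

variable {ι : Type} [LinearOrder ι] {A : Type u} [CommRing A]
variable {𝕂 : Type v} [AddCommGroup 𝕂] [Module A 𝕂] {𝕂' : Type v} [AddCommGroup 𝕂'] [Module A 𝕂']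
variable {F : Finset ι → Submodule A 𝕂} {G : Finset ι → Submodule A 𝕂'}
variable (ψ : 𝕂 →ₗ[A] 𝕂') (hψ : ∀ s, ∀ x ∈ F s, ψ x ∈ G s) (hF : Monotone F) (hG : Monotone G)
variable {𝕂'' : Type v} [AddCommGroup 𝕂''] [Module A 𝕂''] {E : Finset ι → Submodule A 𝕂''} (hE : Monotone E)
variable (φ : 𝕂'' →ₗ[A] 𝕂) (hφ : ∀ s, ∀ x ∈ E s, φ x ∈ F s)

/-- `Cochain.map` is surjective in each degree as soon as `ψ` maps `F s` onto `G s` for every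
NON-EMPTY `s`. [folklore] -/
theorem Cochain.map_surjective_of_nonempty {n : ℤ}
    (hsurj : ∀ s, s.Nonempty → ∀ y ∈ G s, ∃ x ∈ F s, ψ x = y) :
    Function.Surjective (Cochain.map ψ hψ n) := by
  intro g
  choose x hx hψx using fun σ : Simplex ι n => hsurj σ.1 σ.2.1 _ (g σ).2
  exact ⟨fun σ => ⟨x σ, hx σ⟩, funext fun σ => Subtype.ext (hψx σ)⟩

/-- `Cochain.map` is injective in each degree as soon as `φ` is injective on `E s` for every
NON-EMPTY `s`. [folklore] -/
theorem Cochain.map_injective_of_nonempty {n : ℤ}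
    (hinj : ∀ s, s.Nonempty → ∀ x ∈ E s, φ x = 0 → x = 0) :
    Function.Injective (Cochain.map (G := F) φ hφ n) := by
  intro g g' h
  rw [← sub_eq_zero] at h ⊢
  rw [← map_sub] at h
  funext σ
  apply Subtype.ext
  have := congr_arg (fun c : Cochain F n => (c σ : 𝕂)) h
  simp only [Cochain.coe_map_apply] at this
  exact hinj σ.1 σ.2.1 _ ((g - g') σ).2 this

/-- **A sequence of families which is short exact on every non-empty index set gives a short exact
sequence of ordered Čech complexes** `0 → Č(E) → Č(F) → Č(G) → 0` (the complexes only see the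
simplices `s ≠ ∅`; exactness is checked degreewise, Mathlib
`HomologicalComplex.shortExact_of_degreewise_shortExact`). [folklore] -/
theorem shortExact_familySC_of_nonempty (hinj : ∀ s, s.Nonempty → ∀ x ∈ E s, φ x = 0 → x = 0)
    (hsurj : ∀ s, s.Nonempty → ∀ y ∈ G s, ∃ x ∈ F s, ψ x = y)
    (hcomp : ∀ s, ∀ x ∈ E s, ψ (φ x) = 0)
    (hex : ∀ s, s.Nonempty → ∀ x ∈ F s, ψ x = 0 → ∃ w ∈ E s, φ w = x) :
    (familySC ψ hψ hF hG hE φ hφ hcomp).ShortExact := by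
  apply HomologicalComplex.shortExact_of_degreewise_shortExact
  intro n
  apply ModuleCat.shortComplex_shortExact
  · -- exactness in the middle
    intro g
    constructor
    · intro hg
      change Cochain.map ψ hψ n g = 0 at hg
      choose w hw hφw using fun σ : Simplex ι n =>
        hex σ.1 σ.2.1 _ (g σ).2 (by
          have := congr_arg (fun c : Cochain G n => (c σ : 𝕂')) hg
          exact this)
      refine ⟨fun σ => ⟨w σ, hw σ⟩, ?_⟩
      change Cochain.map φ hφ n _ = g
      exact funext fun σ => Subtype.ext (hφw σ)
    · rintro ⟨g', rfl⟩
      change Cochain.map ψ hψ n (Cochain.map φ hφ n g') = 0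
      funext σ; apply Subtype.ext
      exact hcomp σ.1 _ (g' σ).2
  · exact Cochain.map_injective_of_nonempty φ hφ hinj
  · exact Cochain.map_surjective_of_nonempty ψ hψ hsurj

end OrderedCech

end Literature.Algebra.Homology

end
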